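import Summits.AnomalousDissipation.AnomalousDissipation.Theorems.MomentParityGalerkinInvariantLoudStubKrylovBogoliubov
import Summits.AnomalousDissipation.AnomalousDissipation.Theorems.MomentParityMomentLadderLine

/-!
# Crux `MomentParity.MomentLadder` (stmt-AnomalousDissipation-11463), line `Sketch`: the TRAJECTORY CORNER —
# one Galerkin orbit per `(j, N)` with `N`-uniform time statistics of the enstrophy tail gives the crux

`momentLadder_iff_mod` (landed, `Theorems/MomentParityMomentLadderLine.lean`) identifies the crux with the loud
Galerkin-invariant rung whose enstrophy `Z = ‖∇u‖²` has an `N`-free uniform-integrability modulus. This file reads that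
characterization ON ONE TRAJECTORY, the currency of converged DNS: Krylov–Bogoliubov at level `N` in the
MomentLadder currency.

* `krylovBogoliubov_ui` — for `ν > 0`, a smooth divergence-free mean-zero force `f`, a level `N` and a mean-zero Galerkin
  datum `a` whose orbit `u(t) = galerkinFlow ν f N t a` has, EVENTUALLY IN `T`, running time means of the energy `≤ E`, of
  the dissipation `ν‖∇u‖²` `≥ ε`, and of every enstrophy tail `(‖∇u‖² − M)₊` `≤ ω M`, some Borel probability law on
  `H = L²_σ(T³)` is level-`N` carried, supported in the absorbing ball `‖u‖ ≤ ‖f‖₂/(4π²ν)`, polynomially stationary at every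
  degree, with mean energy `≤ E`, dissipation `≥ ε` and `∫ (Z − M)₊ dμ ≤ ω M` for all `M` (a weak-* cluster point of the
  Cesàro measures; every constraint is a CLOSED constraint on the time means of a CONTINUOUS observable of the compact
  level ball, so it passes — this is why the tails are cut off continuously);
* `lintegral_tail_le_of_integral_posPart_le` — continuous tails dominate sharp tails: `∫_{Z > K} Z dμ ≤ 2 ∫ (Z − ⌊K/2⌋)₊ dμ`;
* `MomentLadder_of_oneTrajectoryUI` — **the trajectory corner**: `∃ f` smooth div-free mean-zero, `ν_j → 0`, `E`, `ε > 0`,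
  `∀ j ∃ ω_j → 0, ∃ᶠ N, ∃ a` (mean-zero Galerkin datum of order `N`) whose orbit at `(ν_j, f, N)` has eventual time means
  energy `≤ E`, dissipation `≥ ε`, tails `(Z − M)₊ ≤ ω_j M` **⟹ `MomentLadder`**. One well-resolved run per `(j, N)`,
  `N`-frequently, with an `N`-UNIFORM modulus for the time-averaged enstrophy tail: the zeroth law plus "no pile-up at the
  cutoff" exactly as DNS practice reports it (Kaneda et al. 2003), made a sufficient condition of the crux by name.
  (By the outer `∃ E ε ω`, "eventually `≤`" is as general as `limsup ≤` here.)

References: Krylov–Bogoliubov 1937; Foias–Manley–Rosa–Temam 2001, Ch. IV §2–3, App. B; Constantin–Foias 1988, Ch. 8;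
Kaneda–Ishihara–Yokokawa–Itakura–Uno 2003 (doi:10.1063/1.1539855).
-/

set_option linter.dupNamespace false

noncomputable section

namespace Summit.AnomalousDissipation.AnomalousDissipation.Theorems.MomentLadder

open MeasureTheory Filter Topology Set UnitAddTorus
open scoped ENNReal InnerProductSpace RealInnerProductSpace
open Literature.Analysis.FunctionSpaces Literature.Analysis.FluidPDE
open Summit.AnomalousDissipation.AnomalousDissipation.Theses.MomentParity
open Summit.AnomalousDissipation.AnomalousDissipation.Theorems.QuarticGate.Negative
open Summit.AnomalousDissipation.AnomalousDissipation.Theorems.MomentLadder.Negative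
open Summit.AnomalousDissipation.AnomalousDissipation.Theorems.CubicParityLoud.Negative (T3 R3 H3 L2T3 norm_toLp_eq_sqrt)
open Summit.AnomalousDissipation.AnomalousDissipation.Theorems.MomentParity
  (toLp_realTrigPoly_mem_energySpace nsGeneratorPairing_eq_sum_re_inner_galerkinField band_of_band₀)
open Summit.AnomalousDissipation.AnomalousDissipation.Theorems.MomentParityMomentClosure
  (exists_limit_measure_of_isCompact isCompact_levelBall continuous_nsGeneratorPairing_polyGrad nsGeneratorPairing_polyGrad
   continuous_eval_pderiv continuous_bandEnstrophy bandEnstrophy_nonneg lintegral_eGradNormSq_eq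
   integrable_of_continuous_of_ae_mem eGradNormSq_coe_of_isLevel lintegral_eq_ofReal_integral)
open Summit.AnomalousDissipation.AnomalousDissipation.Theorems.GalerkinInvariantLoud.Negative (IsInvariant ae_norm_le_absorbing)
open Summit.AnomalousDissipation.AnomalousDissipation.Theorems.GalerkinInvariantLoud.KrylovBogoliubov

/-! ## Time means along integer horizons -/

/-- An eventual (real-time) statement holds eventually along the integer horizons `T_n = n + 1`. [folklore] -/
theorem eventually_nat_add_one_of_eventually_atTop {p : ℝ → Prop} (h : ∀ᶠ T in atTop, p T) :
    ∀ᶠ n : ℕ in atTop, p ((n : ℝ) + 1) :=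
  (tendsto_atTop_add_const_right _ 1 tendsto_natCast_atTop_atTop).eventually h

/-! ## Continuous tails dominate sharp tails -/

/-- On level-`N` fields supported in a ball, the sharp enstrophy tail is dominated by twice the continuous tail at half the
threshold: `∫_{Z > K} Z dμ ≤ 2 ∫ (Z − ⌊K/2⌋)₊ dμ` (`Z = ‖∇u‖²`, spectrally the band enstrophy). Pointwise: `Z > K ≥ 2⌊K/2⌋`
gives `Z ≤ 2 (Z − ⌊K/2⌋)`. [folklore] -/
theorem lintegral_tail_le_of_integral_posPart_le {N : ℕ} {R : ℝ} (hR : 0 ≤ R) {μ : Measure H3} [IsFiniteMeasure μ]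
    (hμ : ∀ᵐ u ∂μ, u ∈ {u : H3 | IsLevel N u ∧ ‖u‖ ≤ R}) (K : ℕ) {w : ℝ}
    (hw : ∫ u, max (4 * Real.pi ^ 2 * ∑ k ∈ Torus.freqBall N, Torus.freqNormSq k *
        ‖mFourierCoeff (EuclideanSpace.complexify ∘ ((u : H3).1 : T3 → R3)) k‖ ^ 2 - ((K / 2 : ℕ) : ℝ)) 0 ∂μ ≤ w) :
    ∫⁻ u in {u : H3 | (K : ℝ≥0∞) < Torus.eGradNormSq (u.1 : T3 → R3)}, Torus.eGradNormSq (u.1 : T3 → R3) ∂μ ≤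
      ENNReal.ofReal (2 * w) := by
  set b : H3 → ℝ := fun u => 4 * Real.pi ^ 2 * ∑ k ∈ Torus.freqBall N, Torus.freqNormSq k *
    ‖mFourierCoeff (EuclideanSpace.complexify ∘ ((u : H3).1 : T3 → R3)) k‖ ^ 2 with hb_def
  set Z : H3 → ℝ≥0∞ := fun u => Torus.eGradNormSq (u.1 : T3 → R3) with hZ_def
  set M : ℕ := K / 2 with hM_def
  have hbc : Continuous b := continuous_bandEnstrophy _
  have hb0 : ∀ u, 0 ≤ b u := fun u => bandEnstrophy_nonneg _ u
  have htc : Continuous fun u => max (b u - (M : ℝ)) 0 := (hbc.sub continuous_const).max continuous_const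
  have hti : Integrable (fun u => max (b u - (M : ℝ)) 0) μ :=
    integrable_of_continuous_of_ae_mem (isCompact_levelBall N hR) hμ htc
  have hZm : Measurable Z := Torus.measurable_eGradNormSq_coe
  have hmeas : MeasurableSet {u : H3 | (K : ℝ≥0∞) < Z u} := measurableSet_lt measurable_const hZm
  -- pointwise domination, a.e. (on level-`N` fields `Z = ofReal b`)
  have hdom : ∀ᵐ u ∂μ, {u : H3 | (K : ℝ≥0∞) < Z u}.indicator Z u ≤ ENNReal.ofReal (2 * max (b u - (M : ℝ)) 0) := by
    filter_upwards [hμ] with u hu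
    have hZb : Z u = ENNReal.ofReal (b u) := eGradNormSq_coe_of_isLevel hu.1
    by_cases hK : (K : ℝ≥0∞) < Z u
    · rw [indicator_of_mem (show u ∈ {u : H3 | (K : ℝ≥0∞) < Z u} from hK), hZb]
      refine ENNReal.ofReal_le_ofReal ?_
      rw [hZb] at hK
      have hKb : (K : ℝ) < b u := by
        have h := (ENNReal.ofReal_lt_ofReal_iff_of_nonneg (Nat.cast_nonneg K)).1
          (by simpa [ENNReal.ofReal_natCast] using hK)
        exact h
      have hMK : 2 * (M : ℝ) ≤ K := by
        have h : 2 * M ≤ K := by rw [hM_def]; omega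
        exact_mod_cast h
      have h1 : b u ≤ 2 * (b u - M) := by linarith
      exact h1.trans (by
        have := le_max_left (b u - (M : ℝ)) 0
        linarith)
    · rw [indicator_of_notMem (show u ∉ {u : H3 | (K : ℝ≥0∞) < Z u} from hK)]
      exact zero_le
  calc ∫⁻ u in {u : H3 | (K : ℝ≥0∞) < Z u}, Z u ∂μ
      = ∫⁻ u, {u : H3 | (K : ℝ≥0∞) < Z u}.indicator Z u ∂μ := (lintegral_indicator hmeas _).symm
    _ ≤ ∫⁻ u, ENNReal.ofReal (2 * max (b u - (M : ℝ)) 0) ∂μ := lintegral_mono_ae hdom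
    _ = ENNReal.ofReal (∫ u, 2 * max (b u - (M : ℝ)) 0 ∂μ) := by
        rw [← ofReal_integral_eq_lintegral_ofReal (hti.const_mul 2)
          (ae_of_all _ fun u => mul_nonneg zero_le_two (le_max_right _ _))]
    _ ≤ ENNReal.ofReal (2 * w) := by
        refine ENNReal.ofReal_le_ofReal ?_
        rw [integral_const_mul]
        exact mul_le_mul_of_nonneg_left hw zero_le_two

/-! ## Krylov–Bogoliubov at level `N`, MomentLadder currency -/

/-- **Krylov–Bogoliubov at level `N` with energy, dissipation and enstrophy-tail statistics.** For `ν > 0`, a smooth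
divergence-free mean-zero force `f`, a level `N` and a mean-zero Galerkin datum `a` of order `N` whose orbit
`u(t) = galerkinFlow ν f N t a` has eventual running time means: energy `T⁻¹∫₀ᵀ∫|u|² ≤ E`, dissipation `T⁻¹ ν∫₀ᵀ‖∇u‖² ≥ ε`,
enstrophy tails `T⁻¹∫₀ᵀ (‖∇u‖² − M)₊ ≤ ω M` for every `M : ℕ`, some Borel probability law on `H` is level-`N` carried,
supported in the absorbing ball `‖u‖ ≤ ‖f‖₂/(4π²ν)`, polynomially stationary at every degree, with mean energy `≤ E`,
dissipation `≥ ε` and `∫ (Z − M)₊ dμ ≤ ω M` for all `M`. [folklore] -/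
theorem krylovBogoliubov_ui {ν : ℝ} {f a : T3 → R3} {N : ℕ} (hν : 0 < ν) (hfs : Torus.IsSmooth f)
    (hfz : Torus.HasZeroMean f) (ha : IsGalerkinMode N a) (ha0 : Torus.HasZeroMean a) {E ε : ℝ} {ω : ℕ → ℝ}
    (hE : ∀ᶠ T in atTop, T⁻¹ * ∫ t in (0 : ℝ)..T, (∫ x, ‖Torus.galerkinFlow ν f N t a x‖ ^ 2) ≤ E)
    (hε : ∀ᶠ T in atTop, ε ≤ T⁻¹ * (ν * (∫⁻ t in Ioo 0 T, Torus.eGradNormSq (Torus.galerkinFlow ν f N t a)).toReal))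
    (hω : ∀ M : ℕ, ∀ᶠ T in atTop,
      T⁻¹ * ∫ t in (0 : ℝ)..T, max ((Torus.eGradNormSq (Torus.galerkinFlow ν f N t a)).toReal - (M : ℝ)) 0 ≤ ω M) :
    ∃ μ : Measure (Torus.energySpace (Fin 3)),
      IsProbabilityMeasure μ ∧ (∀ᵐ u ∂μ, IsLevel N u) ∧
      IsSupported (Real.sqrt (∫ x, ‖f x‖ ^ 2) / (4 * Real.pi ^ 2 * ν)) μ ∧
      (∀ d : ℕ, IsPolyStationary ν f N d μ) ∧
      Torus.ensembleEnergy μ ≤ E ∧ ε ≤ Torus.ensembleDissipation ν μ ∧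
      ∀ M : ℕ, ∫ u, max (4 * Real.pi ^ 2 * ∑ k ∈ Torus.freqBall N, Torus.freqNormSq k *
        ‖mFourierCoeff (EuclideanSpace.complexify ∘ ((u : H3).1 : T3 → R3)) k‖ ^ 2 - (M : ℝ)) 0 ∂μ ≤ ω M := by
  have hS : ∀ k ∈ Torus.freqBall (d := Fin 3) N, -k ∈ Torus.freqBall N := Torus.neg_mem_freqBall_of_mem
  have hfi : Integrable f volume := hfs.integrable
  have hf2 : MemLp f 2 volume := hfs.memLp 2
  -- (A) the coefficient orbit and its lift to `H` (verbatim the construction of `stub_krylovBogoliubov`)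
  set c : ℝ → ↥(Torus.freqBall (d := Fin 3) N) → EuclideanSpace ℂ (Fin 3) := fun t =>
    galerkinCoeffFlow ν (fourierRestrict (Torus.freqBall N) f) t (fourierRestrict (Torus.freqBall N) a) with hc_def
  have hc : IsGalerkinODESolution ν (fourierRestrict (Torus.freqBall N) f) (fourierRestrict (Torus.freqBall N) a) c :=
    isGalerkinODESolution_galerkinCoeffFlow hν.le hS (Torus.isRealCoeff_mFourierCoeff hfi) ha.fourierRestrict_mem
  have hneg : ∀ t, t ≤ 0 → c t = fourierRestrict (Torus.freqBall N) a := fun t ht => galerkinCoeffFlow_of_nonpos ht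
  have hcm : ∀ t, c t ∈ galerkinSubspace (Torus.freqBall N) := hc.mem
  have h0 : ∀ t, c t ⟨0, Torus.zero_mem_freqBall N⟩ = 0 := apply_zero_of_isGalerkinODESolution hfi hfz ha ha0 hc hneg
  have hu : ∀ t, Torus.galerkinFlow ν f N t a =
      Torus.realTrigPoly (Torus.freqBall N) (Torus.coeffExt (Torus.freqBall N) (c t)) := fun t => ha.galerkinFlow_eq t
  set U : ℝ → H3 := fun t =>
    ⟨(Torus.memLp_realTrigPoly (Torus.freqBall N) (Torus.coeffExt (Torus.freqBall N) (c t)) 2).toLp _,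
      (toLp_realTrigPoly_mem_energySpace (hcm t) (h0 t)).1⟩ with hU_def
  have hU : ∀ t, (U t).1 =
      (Torus.memLp_realTrigPoly (Torus.freqBall N) (Torus.coeffExt (Torus.freqBall N) (c t)) 2).toLp _ := fun t => rfl
  have hUc : Continuous U := continuous_lift hU (continuous_of_isGalerkinODESolution hc hneg)
  have hlev : ∀ t, IsLevel N (U t) := isLevel_lift hU hcm h0
  -- the uniform bound and the compact carrier
  set Mx : ℝ := max (∑ k, ‖fourierRestrict (Torus.freqBall N) a k‖ ^ 2)
    ((∫ x, ‖f x‖ ^ 2) / (4 * Real.pi ^ 2 * ν) ^ 2) with hMx_def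
  set R : ℝ := Real.sqrt Mx with hR_def
  have hR : 0 ≤ R := Real.sqrt_nonneg _
  have hUR : ∀ t, ‖U t‖ ≤ R := fun t => by
    rw [hR_def, ← Real.sqrt_sq (norm_nonneg (U t)), norm_lift_sq hU hcm t]
    exact Real.sqrt_le_sqrt (energy_le_of_isGalerkinODESolution hν hf2 hc hneg h0 t)
  set K : Set H3 := {u : H3 | IsLevel N u ∧ ‖u‖ ≤ R} with hK_def
  have hK : IsCompact K := isCompact_levelBall N hR
  have hUK : ∀ t, U t ∈ K := fun t => ⟨hlev t, hUR t⟩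
  -- (B) the cluster measure of the Cesàro averages
  obtain ⟨μ', hμ'P, hμ'K, hlimμ⟩ := exists_cesaro_limit hK hUc hUK
  haveI := hμ'P
  have hμ'L : ∀ᵐ u ∂μ', IsLevel N u := hμ'K.mono fun u hu => hu.1
  have hμ'R : ∀ᵐ u ∂μ', ‖u‖ ≤ R := hμ'K.mono fun u hu => hu.2
  -- (C1) all-order rows
  have hrow : ∀ (m : ℕ) (g : Fin m → T3 → R3) (P : MvPolynomial (Fin m) ℝ), (∀ i, IsBandTest N (g i)) →
      Integrable (fun u => Torus.nsGeneratorPairing ν f u (polyGrad g P u)) μ' ∧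
        ∫ u, Torus.nsGeneratorPairing ν f u (polyGrad g P u) ∂μ' = 0 := by
    intro m g P hg
    have hgs : ∀ i, Torus.IsSmooth (g i) := fun i => (hg i).1
    have hFc : Continuous fun u : H3 => Torus.nsGeneratorPairing ν f u (polyGrad g P u) :=
      continuous_nsGeneratorPairing_polyGrad ν hfi hgs P
    refine ⟨integrable_of_continuous_of_ae_mem hK hμ'K hFc, ?_⟩
    have hΦc : Continuous fun u : H3 => MvPolynomial.eval (fun j => Torus.pairing u.1 (g j)) P :=
      continuous_eval_pderiv hgs P
    obtain ⟨B, hB⟩ := hK.exists_bound_of_continuousOn hΦc.continuousOn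
    refine integral_eq_zero_of_cesaro (hlimμ _ hFc)
      (Φ := fun t => MvPolynomial.eval (fun j => Torus.pairing (U t).1 (g j)) P)
      (fun T hT => integral_nsGeneratorPairing_polyGrad_lift hc hU hcm h0 hf2 hneg hg P hT) (B := B) fun t _ => ?_
    have h := hB (U t) (hUK t)
    rwa [Real.norm_eq_abs] at h
  have hinv : IsInvariant ν f N μ' := fun m g P hg => hrow m g P hg
  -- the continuous observables: band enstrophy, energy
  set bandE : H3 → ℝ := fun u => 4 * Real.pi ^ 2 * ∑ k ∈ Torus.freqBall N, Torus.freqNormSq k *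
    ‖mFourierCoeff (EuclideanSpace.complexify ∘ ((u : H3).1 : T3 → R3)) k‖ ^ 2 with hbandE_def
  have hbc : Continuous bandE := continuous_bandEnstrophy _
  have hb0 : ∀ u, 0 ≤ bandE u := fun u => bandEnstrophy_nonneg _ u
  have hgrad : ∀ t, Torus.eGradNormSq (Torus.galerkinFlow ν f N t a) = ENNReal.ofReal (bandE (U t)) := fun t => by
    rw [hu t]
    exact eGradNormSq_realTrigPoly_eq_lift hU hcm h0 t
  have hener : ∀ t, ∫ x, ‖Torus.galerkinFlow ν f N t a x‖ ^ 2 = ‖U t‖ ^ 2 := fun t => by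
    rw [hu t, Torus.integral_norm_sq_realTrigPoly hS ((hcm t).1.isConjSymm_coeffExt hS),
      Torus.sum_coeffExt (fun _ v => ‖v‖ ^ 2), norm_lift_sq hU hcm t]
  have hnum : ∀ T, 0 ≤ T → (ν * (∫⁻ t in Ioo 0 T, Torus.eGradNormSq (Torus.galerkinFlow ν f N t a)).toReal) =
      ∫ t in (0 : ℝ)..T, ν * bandE (U t) := by
    intro T hT
    have hint : Integrable (fun t => bandE (U t)) (volume.restrict (Ioo 0 T)) :=
      ((hbc.comp hUc).integrableOn_Icc (a := 0) (b := T)).mono_set Ioo_subset_Icc_self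
    simp_rw [hgrad]
    rw [← ofReal_integral_eq_lintegral_ofReal hint (ae_of_all _ fun t => hb0 _),
      ENNReal.toReal_ofReal (integral_nonneg fun t => hb0 _), intervalIntegral.integral_const_mul,
      intervalIntegral.integral_of_le hT, integral_Ioc_eq_integral_Ioo]
  refine ⟨μ', hμ'P, hμ'L, ?_, fun d m g P hg _ => hrow m g P hg, ?_, ?_, ?_⟩
  · -- (C2) the absorbing radius, from invariance
    have h := ae_norm_le_absorbing hν hf2 hμ'L hμ'R hinv
    rwa [norm_toLp_eq_sqrt] at h
  · -- (C3) mean energy `≤ E`: closed constraint `Iic E` on the time means of `u ↦ ‖u‖²`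
    have hEc : Continuous fun u : H3 => ‖u‖ ^ 2 := continuous_norm.pow 2
    have hmem : (∫ u, ‖u‖ ^ 2 ∂μ') ∈ Iic E := by
      refine hlimμ _ hEc _ isClosed_Iic ?_
      filter_upwards [eventually_nat_add_one_of_eventually_atTop hE] with n hn
      simp_rw [hener] at hn
      exact hn
    exact hmem
  · -- (C4) dissipation `≥ ε`: closed constraint `Ici ε` on the time means of `u ↦ ν · bandE u`
    have hD : Continuous fun u => ν * bandE u := continuous_const.mul hbc
    have hmem : (∫ u, ν * bandE u ∂μ') ∈ Ici ε := by
      refine hlimμ _ hD _ isClosed_Ici ?_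
      filter_upwards [eventually_nat_add_one_of_eventually_atTop hε] with n hn
      have hn0 : (0 : ℝ) ≤ (n : ℝ) + 1 := by positivity
      rwa [hnum _ hn0] at hn
    have hDμ : Torus.ensembleDissipation ν μ' = ν * ∫ u, bandE u ∂μ' := by
      rw [hbandE_def, Torus.ensembleDissipation, Torus.ensembleEnstrophy, lintegral_eGradNormSq_eq hR hμ'K,
        ENNReal.toReal_ofReal (integral_nonneg fun u => bandEnstrophy_nonneg _ u)]
    rw [hDμ, ← integral_const_mul]
    exact hmem
  · -- (C5) the enstrophy tails: closed constraint `Iic (ω M)` on the time means of `u ↦ (bandE u − M)₊`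
    intro M
    have htc : Continuous fun u => max (bandE u - (M : ℝ)) 0 := (hbc.sub continuous_const).max continuous_const
    have hmem : (∫ u, max (bandE u - (M : ℝ)) 0 ∂μ') ∈ Iic (ω M) := by
      refine hlimμ _ htc _ isClosed_Iic ?_
      filter_upwards [eventually_nat_add_one_of_eventually_atTop (hω M)] with n hn
      have htail : ∀ t, max ((Torus.eGradNormSq (Torus.galerkinFlow ν f N t a)).toReal - (M : ℝ)) 0 =
          max (bandE (U t) - (M : ℝ)) 0 := fun t => by
        rw [hgrad t, ENNReal.toReal_ofReal (hb0 _)]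
      simp_rw [htail] at hn
      exact hn
    exact hmem

/-! ## The trajectory corner of the crux -/

/-- **The trajectory corner: one Galerkin orbit per `(j, N)` with `N`-uniform time statistics ⟹ `MomentLadder`.**
Hypothesis (the converged-DNS zeroth law, stated on one run): `∃ f` smooth div-free mean-zero, `ν_j → 0`, `E`, `ε > 0`, and
for every `j` a modulus `ω_j → 0` such that for infinitely many levels `N` some mean-zero Galerkin datum `a` of order `N` has an
orbit at `(ν_j, f, N)` whose running time means satisfy, eventually in `T`: energy `≤ E`, dissipation `≥ ε`, enstrophy tails
`(‖∇u‖² − M)₊ ≤ ω_j M` for every `M`. Proof: `krylovBogoliubov_ui` gives a loud polynomially stationary level-`N` law in the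
absorbing ball `R_j = ‖f‖₂/(4π²ν_j)` with `∫ (Z − M)₊ ≤ ω_j M`; continuous tails dominate sharp tails
(`lintegral_tail_le_of_integral_posPart_le`), so `K ↦ 2 ω_j ⌊K/2⌋` is an `N`-free UI modulus of the enstrophy, and
`MomentLadder_of_mod` (the landed characterization) concludes the crux BY NAME. [folklore] -/
theorem MomentLadder_of_oneTrajectoryUI :
    (∃ f : UnitAddTorus (Fin 3) → EuclideanSpace ℝ (Fin 3),
      Torus.IsSmooth f ∧ Torus.IsDivFree f ∧ Torus.HasZeroMean f ∧
      ∃ (ν : ℕ → ℝ) (E ε : ℝ), (∀ j, 0 < ν j) ∧ Tendsto ν atTop (𝓝 0) ∧ 0 < ε ∧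
        ∀ j : ℕ, ∃ ω : ℕ → ℝ, Tendsto ω atTop (𝓝 0) ∧ ∃ᶠ N in atTop,
          ∃ a : UnitAddTorus (Fin 3) → EuclideanSpace ℝ (Fin 3), IsGalerkinMode N a ∧ Torus.HasZeroMean a ∧
            (∀ᶠ T in atTop, T⁻¹ * ∫ t in (0 : ℝ)..T, (∫ x, ‖Torus.galerkinFlow (ν j) f N t a x‖ ^ 2) ≤ E) ∧
            (∀ᶠ T in atTop, ε ≤ T⁻¹ * ((ν j) *
              (∫⁻ t in Ioo 0 T, Torus.eGradNormSq (Torus.galerkinFlow (ν j) f N t a)).toReal)) ∧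
            (∀ M : ℕ, ∀ᶠ T in atTop, T⁻¹ * ∫ t in (0 : ℝ)..T,
              max ((Torus.eGradNormSq (Torus.galerkinFlow (ν j) f N t a)).toReal - (M : ℝ)) 0 ≤ ω M)) →
    MomentLadder := by
  rintro ⟨f, hfs, hfd, hfz, ν, E, ε, hν, hν0, hε, hj⟩
  refine MomentLadder_of_mod ⟨f, hfs, hfd, hfz, ν, E, ε, hν, hν0, hε, fun j => ?_⟩
  obtain ⟨ω, hω0, hfreq⟩ := hj j
  -- the `N`-free modulus `K ↦ ofReal (2 ω ⌊K/2⌋)`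
  refine ⟨Real.sqrt (∫ x, ‖f x‖ ^ 2) / (4 * Real.pi ^ 2 * ν j), fun K => ENNReal.ofReal (2 * ω (K / 2)), ?_,
    hfreq.mono fun N hN => ?_⟩
  · have hdiv : Tendsto (fun K : ℕ => K / 2) atTop atTop := Nat.tendsto_div_const_atTop two_ne_zero
    have h2 : Tendsto (fun K : ℕ => 2 * ω (K / 2)) atTop (𝓝 0) := by
      simpa using (hω0.comp hdiv).const_mul 2
    simpa using ENNReal.tendsto_ofReal h2
  · obtain ⟨a, ha, ha0, hE, hεT, hωT⟩ := hN
    obtain ⟨μ, hP, hlev, hsupp, hstat, hEμ, hεμ, htail⟩ := krylovBogoliubov_ui (hν j) hfs hfz ha ha0 hE hεT hωT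
    haveI := hP
    have hR : 0 ≤ Real.sqrt (∫ x, ‖f x‖ ^ 2) / (4 * Real.pi ^ 2 * ν j) :=
      div_nonneg (Real.sqrt_nonneg _) (by have := hν j; positivity)
    have hμK : ∀ᵐ u ∂μ, u ∈ {u : H3 | IsLevel N u ∧ ‖u‖ ≤ Real.sqrt (∫ x, ‖f x‖ ^ 2) / (4 * Real.pi ^ 2 * ν j)} := by
      filter_upwards [hlev, hsupp] with u hu hu'
      exact ⟨hu, hu'⟩
    exact ⟨μ, hP, hlev, hsupp, hstat, fun K => lintegral_tail_le_of_integral_posPart_le hR hμK K (htail (K / 2)),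
      hEμ, hεμ⟩

end Summit.AnomalousDissipation.AnomalousDissipation.Theorems.MomentLadder

end
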